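import Literature.Topology.FourManifolds.RegularLevelCollar
import Literature.Geometry.Manifold.VectorSpaceGlobalFlow
import HarnessLib

/-!
# Level slides: smooth flows of unit speed across a level, and the slide induced on a regular
# level of Euclidean space by an ambient compactly supported field

Topic `Literature/Topology/FourManifolds`; infrastructure for brick E3 of the constructive road
(P1′) to `Literature.Topology.FourManifolds.Trisection.isConnectedSum_of_reducing_separating`
(`ReducibleTrisectionSplitting.lean`, § Status).  The straightening of an embedded surface near
regular slabs (`LevelSlabStraightening.lean`) uses, of the unit-speed field `U_N` on the ambient
manifold `N`, only its **flow**: a smooth `ℝ`-family `fl : N → ℝ → N` with `fl x 0 = x`, the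
group law, and the clock `S (fl x t) = S x + t` across the band `|S - a| < δ`.  We record this
interface as a structure, `LevelSlide n S a` (§1; every `LevelUnitField` gives one,
`LevelUnitField.toLevelSlide`), so that flows known **explicitly** can be fed to the
straightening: §3 constructs the level slide induced on a regular level `{G = c} ⊂ ℝᵐ⁺²` by the
global flow `θ` (`Literature.Geometry.Manifold.exists_contDiff_globalFlow`, Lee 2012, Thm. 9.16)
of a compactly supported smooth field `V` with `dG(V) = λ · (G - c)` (so that the level is
invariant, §2: a scalar linear ODE `u' = λ u` with `u(0) = 0` has only the zero solution) and
`dS(V) = 1` on the level near `S = a` (`LevelSlide.exists_ofAmbient`, with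
`incl (fl p t) = θ (t, incl p)`).

Everything is **proved**; no named fact is introduced.

## References
* J. Milnor, *Morse theory* (1963), proof of Thm. 3.1 (the clock `t ↦ f(φ_t(q))`). [Milnor1963]
* J. M. Lee, *Introduction to Smooth Manifolds*, 2nd ed. (2012), Thm. 9.12, Thm. 9.16.
  [LeeSmoothManifolds2013]
-/

noncomputable section

open scoped Topology ContDiff Manifold
open Set Filter

namespace Literature.Topology.FourManifolds

universe u

/-- Local notation: `𝔼 n` is the model Euclidean space `EuclideanSpace ℝ (Fin n)`. -/
local notation "𝔼 " n:arg => EuclideanSpace ℝ (Fin n)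

/-! ### §1 Level slides -/

/-- A **level slide** across the level `a` of `f`: a smooth `ℝ`-family of diffeomorphisms
`fl x t` of `M` with `fl x 0 = x`, the group law, and unit speed across the band:
`f (fl x t) = f x + t` while `f x` and `f x + t` stay in `(a - δ, a + δ)` (the flow of a
unit-speed field, Milnor 1963, proof of Thm. 3.1, abstracted to its flow).
[cite: Milnor1963, proof of Thm. 3.1] -/
structure LevelSlide (n : ℕ) {M : Type u} [TopologicalSpace M] [ChartedSpace (𝔼 (n + 1)) M]
    [IsManifold (𝓡 (n + 1)) ∞ M] (f : M → ℝ) (a : ℝ) where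
  /-- The flow. -/
  fl : M → ℝ → M
  /-- It is smooth jointly. -/
  contMDiff_fl : ContMDiff ((𝓡 (n + 1)).prod 𝓘(ℝ, ℝ)) (𝓡 (n + 1)) ∞ fun p : M × ℝ => fl p.1 p.2
  /-- The function is smooth. -/
  contMDiff_f : ContMDiff (𝓡 (n + 1)) 𝓘(ℝ, ℝ) ∞ f
  /-- Time `0` is the identity. -/
  fl_zero : ∀ x, fl x 0 = x
  /-- The group law. -/
  fl_add : ∀ x s t, fl x (s + t) = fl (fl x s) t
  /-- The half-width of the band. -/
  δ : ℝ
  /-- The band has positive width. -/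
  δ_pos : 0 < δ
  /-- The clock across the band. -/
  apply_fl_eq_add' : ∀ ⦃x : M⦄ ⦃t : ℝ⦄, f x ∈ Ioo (a - δ) (a + δ) → f x + t ∈ Ioo (a - δ) (a + δ) →
    f (fl x t) = f x + t

namespace LevelSlide

/-! The derived API of `LevelUnitField` (`fl_neg_fl`, `contMDiff_fl_apply`, `apply_fl_eq_add`,
…) holds verbatim for level slides; to avoid restating landed lemmas it is inlined at the points
of use (`by rw [← U.fl_add, add_neg_cancel, U.fl_zero]`,
`U.contMDiff_fl.comp (contMDiff_id.prodMk contMDiff_const)`, the field `apply_fl_eq_add'`). -/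

end LevelSlide

/-- **A unit-speed field across a level gives a level slide** (its flow).
[cite: Milnor1963, proof of Thm. 3.1] -/
def LevelUnitField.toLevelSlide {n : ℕ} {M : Type u} [TopologicalSpace M] [T2Space M] [CompactSpace M]
    [ChartedSpace (𝔼 (n + 1)) M] [IsManifold (𝓡 (n + 1)) ∞ M] {f : M → ℝ} {a : ℝ}
    (U : LevelUnitField n f a) : LevelSlide n f a where
  fl := U.fl
  contMDiff_fl := U.contMDiff_fl
  contMDiff_f := U.contMDiff_f
  fl_zero := U.fl_zero
  fl_add := U.fl_add
  δ := U.δ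
  δ_pos := U.δ_pos
  apply_fl_eq_add' := fun _ _ hx hxt => U.apply_fl_eq_add hx hxt

/-- The flow of the induced slide is the flow of the field (definitional). [folklore] -/
@[simp] theorem LevelUnitField.toLevelSlide_fl {n : ℕ} {M : Type u} [TopologicalSpace M] [T2Space M]
    [CompactSpace M] [ChartedSpace (𝔼 (n + 1)) M] [IsManifold (𝓡 (n + 1)) ∞ M] {f : M → ℝ} {a : ℝ}
    (U : LevelUnitField n f a) : U.toLevelSlide.fl = U.fl := rfl

/-! ### §2 A scalar linear ODE with zero initial value -/

/-- **`u' = λ u`, `u(t₀) = 0` ⇒ `u ≡ 0`** for continuous `λ`: `(u · exp(-∫λ))' = 0`.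
[folklore] -/
theorem eq_zero_of_hasDerivAt_eq_mul {u l : ℝ → ℝ} (hl : Continuous l)
    (hu : ∀ t, HasDerivAt u (l t * u t) t) (h0 : u 0 = 0) (t : ℝ) : u t = 0 := by
  set L : ℝ → ℝ := fun t => ∫ s in (0 : ℝ)..t, l s with hL
  have hLd : ∀ t, HasDerivAt L (l t) t := fun t =>
    intervalIntegral.integral_hasDerivAt_right (hl.intervalIntegrable _ _)
      hl.aestronglyMeasurable.stronglyMeasurableAtFilter hl.continuousAt
  have hw : ∀ t, HasDerivAt (fun t => u t * Real.exp (-L t)) 0 t := fun t => by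
    have h := (hu t).mul ((hLd t).neg.exp)
    have e : (0 : ℝ) = l t * u t * Real.exp (-L t) + u t * (Real.exp (-L t) * -l t) := by ring
    rw [e]; exact h
  have hc := is_const_of_deriv_eq_zero (f := fun t => u t * Real.exp (-L t))
    (fun t => (hw t).differentiableAt) (fun t => (hw t).deriv) t 0
  simp only [h0, zero_mul, mul_eq_zero, Real.exp_ne_zero, or_false] at hc
  exact hc

/-- **A level `{G = c}` is invariant under the flow of a field `V` with `dG(V) = λ (G - c)`.**
[folklore] -/
theorem apply_flow_eq_of_fderiv_comp_eq_mul {E : Type*} [NormedAddCommGroup E] [NormedSpace ℝ E]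
    {θ : ℝ × E → E} {V : E → E} (hθ : Continuous θ) (h0 : ∀ x, θ (0, x) = x)
    (hint : ∀ x t, HasDerivAt (fun t => θ (t, x)) (V (θ (t, x))) t)
    {G : E → ℝ} {c : ℝ} (hG : Differentiable ℝ G) {l : E → ℝ} (hl : Continuous l)
    (hGV : ∀ x, fderiv ℝ G x (V x) = l x * (G x - c)) {x : E} (hx : G x = c) (t : ℝ) :
    G (θ (t, x)) = c := by
  have hu : ∀ s, HasDerivAt (fun s => G (θ (s, x)) - c) (l (θ (s, x)) * (G (θ (s, x)) - c)) s := fun s => by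
    have h := ((hG (θ (s, x))).hasFDerivAt.comp_hasDerivAt s (hint x s)).sub_const c
    rw [hGV] at h
    exact h
  have hcont : Continuous fun s => l (θ (s, x)) := hl.comp (hθ.comp (continuous_id.prodMk continuous_const))
  have := eq_zero_of_hasDerivAt_eq_mul hcont hu (by simp [h0, hx]) t
  linarith

/-! ### §3 The slide induced on a regular level of `ℝᵐ⁺²` by an ambient field -/

section Ambient

variable {m : ℕ} {G : 𝔼 (m + 2) → ℝ} {c : ℝ}

/-- **The level slide induced by an ambient field.**  Let `c` be a regular level of the smooth
`G : ℝᵐ⁺² → ℝ`, `V` a smooth field vanishing off a compact set with `dG(V) = λ · (G - c)`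
(`λ` continuous), and `S` smooth with `dS(V) = 1` at the points of the level with
`|S - a| < δ`.  Then the global flow `θ` of `V` (Lee 2012, Thm. 9.16) preserves the level and
restricts to a level slide for `S ∘ incl` across `a` of half-width `δ`, with
`incl (fl p t) = θ (t, incl p)`. [cite: LeeSmoothManifolds2013, Thm. 9.16 and Thm. 9.12] -/
theorem LevelSlide.exists_ofAmbient (h : IsRegularLevel (𝓡 (m + 2)) G c)
    {V : 𝔼 (m + 2) → 𝔼 (m + 2)} (hV : ContDiff ℝ ∞ V) {K : Set (𝔼 (m + 2))} (hK : IsCompact K)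
    (hVK : ∀ x, x ∉ K → V x = 0) {l : 𝔼 (m + 2) → ℝ} (hl : Continuous l)
    (hGV : ∀ x, fderiv ℝ G x (V x) = l x * (G x - c))
    {S : 𝔼 (m + 2) → ℝ} (hS : ContDiff ℝ ∞ S) {a δ : ℝ} (hδ : 0 < δ)
    (hSV : ∀ x, G x = c → S x ∈ Ioo (a - δ) (a + δ) → fderiv ℝ S x (V x) = 1) :
    ∃ (θ : ℝ × 𝔼 (m + 2) → 𝔼 (m + 2)) (U : LevelSlide m (S ∘ RegularLevel.incl h) a),
      ContDiff ℝ ∞ θ ∧ (∀ x, θ (0, x) = x) ∧ (∀ t s x, θ (t, θ (s, x)) = θ (t + s, x)) ∧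
      (∀ x t, HasDerivAt (fun t => θ (t, x)) (V (θ (t, x))) t) ∧
      (∀ x, V x = 0 → ∀ t, θ (t, x) = x) ∧ U.δ = δ ∧
      ∀ p t, RegularLevel.incl h (U.fl p t) = θ (t, RegularLevel.incl h p) := by
  obtain ⟨θ, hθ, h0, hgrp, hint, hfix⟩ :=
    Literature.Geometry.Manifold.exists_contDiff_globalFlow hV hK hVK
  have hGd : Differentiable ℝ G := (contMDiff_iff_contDiff.1 h.contMDiff).differentiable (by simp)
  have hinv : ∀ x, G x = c → ∀ t, G (θ (t, x)) = c := fun x hx t =>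
    apply_flow_eq_of_fderiv_comp_eq_mul hθ.continuous h0 hint hGd hl hGV hx t
  -- the flow on the level
  set N := RegularLevel h
  let fl : N → ℝ → N := fun p t => ⟨θ (t, p.1), hinv p.1 p.2 t⟩
  have hincl : ∀ p t, RegularLevel.incl h (fl p t) = θ (t, RegularLevel.incl h p) := fun p t => rfl
  have hι := RegularLevel.isSmoothEmbedding_incl h
  -- smoothness into the level
  have hcomp : ContMDiff ((𝓡 (m + 1)).prod 𝓘(ℝ, ℝ)) (𝓡 (m + 2)) ∞
      (RegularLevel.incl h ∘ fun q : N × ℝ => fl q.1 q.2) := by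
    have h1 : ContMDiff ((𝓡 (m + 1)).prod 𝓘(ℝ, ℝ)) 𝓘(ℝ, ℝ × 𝔼 (m + 2)) ∞
        fun q : N × ℝ => (q.2, RegularLevel.incl h q.1) :=
      contMDiff_snd.prodMk_space ((RegularLevel.contMDiff_incl h).comp contMDiff_fst)
    have h2 : ContMDiff 𝓘(ℝ, ℝ × 𝔼 (m + 2)) (𝓡 (m + 2)) ∞ θ := by
      rw [contMDiff_iff_contDiff]; exact hθ
    exact h2.comp h1
  have hflC : ContMDiff ((𝓡 (m + 1)).prod 𝓘(ℝ, ℝ)) (𝓡 (m + 1)) ∞ fun q : N × ℝ => fl q.1 q.2 := by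
    intro q
    have hcont : ContinuousAt (fun q : N × ℝ => fl q.1 q.2) q := by
      rw [hι.isEmbedding.isInducing.continuousAt_iff]
      exact (hcomp q).continuousAt
    exact (ContMDiffAt.iff_comp_isImmersionAt (hι.isImmersion.isImmersionAt _)).2 ⟨hcont, hcomp q⟩
  have hSf : ContMDiff (𝓡 (m + 1)) 𝓘(ℝ, ℝ) ∞ (S ∘ RegularLevel.incl h) :=
    (contMDiff_iff_contDiff.2 hS).comp (RegularLevel.contMDiff_incl h)
  -- the clock
  have hclock : ∀ ⦃p : N⦄ ⦃t : ℝ⦄, (S ∘ RegularLevel.incl h) p ∈ Ioo (a - δ) (a + δ) →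
      (S ∘ RegularLevel.incl h) p + t ∈ Ioo (a - δ) (a + δ) →
      (S ∘ RegularLevel.incl h) (fl p t) = (S ∘ RegularLevel.incl h) p + t := by
    intro p t hp hpt
    simp only [Function.comp_apply] at hp hpt ⊢
    show S (θ (t, p.1)) = S p.1 + t
    set g : ℝ → ℝ := fun s => S (θ (s, p.1)) with hg
    set g' : ℝ → ℝ := fun s => fderiv ℝ S (θ (s, p.1)) (V (θ (s, p.1))) with hg'
    have hderiv : ∀ s, HasDerivAt g (g' s) s := fun s =>
      (hS.differentiable (by simp) (θ (s, p.1))).hasFDerivAt.comp_hasDerivAt s (hint p.1 s)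
    have hband : ∀ s, g s ∈ Ioo (a - δ) (a + δ) → g' s = 1 := fun s hs =>
      hSV _ (hinv p.1 p.2 s) hs
    have hg0 : g 0 = S p.1 := by simp [hg, h0]
    rcases le_total 0 t with ht | ht
    · have key := UnitSpeed.eq_add_of_deriv_eq_one hderiv hband (t₀ := 0) (T := t)
        (by rw [hg0]; exact hp.1) (by rw [hg0]; exact hpt.2) t ⟨ht, le_rfl⟩
      simpa [hg0] using key
    · have hGderiv := UnitSpeed.hasDerivAt_neg_comp_sub hderiv 0
      have hGband := UnitSpeed.band_neg_comp_sub hband 0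
      have key := UnitSpeed.eq_add_of_deriv_eq_one hGderiv hGband (t₀ := 0) (T := -t)
        (by simp only [sub_zero, hg0]; linarith [hp.2]) (by simp only [sub_zero, hg0]; linarith [hpt.1])
        (-t) ⟨by linarith, le_rfl⟩
      simp only [zero_add, sub_zero, hg0, zero_sub, neg_neg] at key
      have : g t = S p.1 + t := by linarith
      exact this
  refine ⟨θ, ⟨fl, hflC, hSf, fun p => ?_, fun p s t => ?_, δ, hδ, hclock⟩, hθ, h0, hgrp, hint, hfix, rfl, hincl⟩
  · exact Subtype.ext (h0 p.1)
  · apply Subtype.ext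
    show θ (s + t, p.1) = θ (t, θ (s, p.1))
    rw [hgrp]
    congr 2
    exact add_comm s t

end Ambient

end Literature.Topology.FourManifolds
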